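import Summits.CriticalPhenomena.PercolationContinuityZ3.Theorems.PercNearOneGluingNoHeavyLowerTailThreePartitionGridOrOr
import HarnessLib.Audit

/-!
# `NoHeavyLowerTail` (crux stmt-CriticalPhenomena-4575), master-family hierarchy P3 (gen 36): the OR–OR class of `TypedGridMatching`, part 2/2 —
# the decoder is a left inverse, hence **`typedMatchable_orOr : TypedMatchable ∅ (OR P) (OR Q)` for all `P, Q`**

Support file (seat `prim-masterthm-p3`; `--supports stmt-CriticalPhenomena-4575`; memo
`run/shared/lean/prim/prim-masterthm/FROM-prim-masterthm-p3-g36-CYLINDER-SLACK.md` §9).  Companion of `…ThreePartitionGridOrOr` (part 1: `orFam`, the explicit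
matching `ororMap`, the decoder `ororInv`, `ororMap_spec`).

THIS FILE.  `ororInv_ororMap`: for every negative token `t` of the untwisted instance `(OR P, OR Q)`, `ororInv (ororMap t) = t` — a case analysis along the
ten branches of the map (self / two diversions / canonical landing for `N1`; self / C-move for `N2`; self / exit / shift / own unit for `N3`), reading off in
each case which branch of the decoder fires.  Hence `ororMap` is injective on the negative tokens and, with the forward spec, **`typedMatchable_orOr`**:
the typed fibre-local token matching EXISTS for every untwisted OR–OR instance — the first kernel class of `TypedGridMatching` whose matching DIVERTS bad
tokens to b-units (the classes `…GridTop`, `…GridBalanced`, `…GridSubset` land every bad token).  It contains the 'triangle' pair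
`(OR{0,1}, OR{0,2})`, the smallest instance on which every landing-only scheme fails (seat census).  Corollary `gtMatchable_orOr` (grid-order matching,
hence `∑_{q∈𝒰} κ ≥ 0` for every grid up-set by `sum_gtKernel_nonneg_of_gtMatchable`).
HONEST LABEL: untwisted (`τ = ∅`) only; `TypedGridMatching`, `GridTransport`, COMB-C3 and Sahi's `C₃` remain OPEN; nothing bears on the (closed) crux. [this work]
-/

noncomputable section

open Finset
open scoped symmDiff Classical

namespace Summit.CriticalPhenomena.PercolationContinuityZ3.Theorems.ThreePartition

variable {ι : Type*} [Fintype ι]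

/-! ## The decoder is a left inverse -/

omit [Fintype ι] in
/-- Pair equality from the two components and the tag. [folklore] -/
private theorem tok_eq {a b c d : Set ι} {i j : Fin 3} (h1 : a = c) (h2 : b = d) (h3 : i = j) :
    ((a, b), i) = ((c, d), j) := by subst h1; subst h2; subst h3; rfl

/-- **Left inverse**: `ororInv (ororMap t) = t` for every negative token `t`. [this work] -/
theorem ororInv_ororMap (P Q : Set ι) {t : (Set ι × Set ι) × Fin 3} (ht : t ∈ negToks (∅ : Set ι) (orFam P) (orFam Q)) :
    ororInv P Q (ororMap P Q t) = t := by
  obtain ⟨⟨x₁, x₂⟩, i⟩ := t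
  rw [mem_negToks_orOr] at ht
  obtain ⟨hdis, hk⟩ := ht
  dsimp only at hdis hk
  have hd : ∀ a, a ∈ x₁ → a ∈ x₂ → False := fun a ha hb => Set.disjoint_left.1 hdis ha hb
  have fin10 : ¬ ((1 : Fin 3) = 0) := by decide
  have fin20 : ¬ ((2 : Fin 3) = 0) := by decide
  have fin21 : ¬ ((2 : Fin 3) = 1) := by decide
  rcases hk with ⟨rfl, hV, hW⟩ | ⟨rfl, hW1, hV2⟩ | ⟨rfl, hP2, hQ2⟩
  · -- N1
    simp only [ororMap, if_true]
    split_ifs with h1 h2 h3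
    · -- self
      simp only [ororInv, if_true]
      rw [if_pos hW]
    · -- diversion case 1: target `((x₁ ∪ x₂ ∩ T, x₂ ∖ T), 1)`
      obtain ⟨h2a, h2b, h2c⟩ := h2
      have hx1Q : ∀ a, a ∈ x₁ → a ∈ Q → False := fun a ha haQ => h1 ⟨a, ha, haQ⟩
      have hx2P : ∀ a, a ∈ x₂ → a ∈ P → a ∈ Q := fun a ha haP => by
        by_contra haQ
        have : a ∈ P \ Q ∩ x₂ := ⟨⟨haP, haQ⟩, ha⟩
        rw [h2a] at this; exact this
      have hu : (x₁ ∪ x₂ ∩ (P ∩ Q)) ∪ x₂ \ (P ∩ Q) = x₁ ∪ x₂ := by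
        ext c; simp only [Set.mem_union, Set.mem_inter_iff, Set.mem_sdiff]; tauto
      simp only [ororInv, fin10, if_false, if_true]
      have c1 : ¬ (x₂ \ (P ∩ Q) ∩ P).Nonempty := by
        rintro ⟨a, ⟨ha2, haT⟩, haP⟩; exact haT ⟨haP, hx2P a ha2 haP⟩
      have c2 : ¬ ((x₁ ∪ x₂ ∩ (P ∩ Q)) ∩ (Q \ P)).Nonempty := by
        rintro ⟨a, ha | ha, haQP⟩
        · exact hx1Q a ha haQP.1
        · exact haQP.2 ha.2.1
      have c3 : (((x₁ ∪ x₂ ∩ (P ∩ Q)) ∪ x₂ \ (P ∩ Q))ᶜ ∩ Q).Nonempty := by rw [hu]; exact hW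
      rw [if_neg c1, if_neg c2, if_pos c3]
      refine tok_eq ?_ ?_ rfl
      · ext c; simp only [Set.mem_sdiff, Set.mem_union, Set.mem_inter_iff]
        constructor
        · rintro ⟨hc | hc, hcT⟩
          · exact hc
          · exact absurd hc.2 hcT
        · intro hc; exact ⟨Or.inl hc, fun hT => hx1Q c hc hT.2⟩
      · ext c; simp only [Set.mem_sdiff, Set.mem_union, Set.mem_inter_iff]
        constructor
        · rintro (⟨hc, _⟩ | ⟨hc | hc, hcT⟩)
          · exact hc
          · exact absurd hcT.2 (fun h => hx1Q c hc h)
          · exact hc.1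
        · intro hc
          by_cases hcT : c ∈ P ∧ c ∈ Q
          · exact Or.inr ⟨Or.inr ⟨hc, hcT⟩, hcT⟩
          · exact Or.inl ⟨hc, hcT⟩
    · -- diversion case 2: target `((x₁ ∪ T, x₂), 1)`
      obtain ⟨h3a, h3b, h3c⟩ := h3
      have hx1Q : ∀ a, a ∈ x₁ → a ∈ Q → False := fun a ha haQ => h1 ⟨a, ha, haQ⟩
      have hTx3 : ∀ c, c ∈ P ∩ Q → c ∉ x₁ ∧ c ∉ x₂ := fun c hc => by
        have : c ∈ (x₁ ∪ x₂)ᶜ ∩ Q := by rw [h3c]; exact hc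
        simpa only [Set.mem_inter_iff, Set.mem_compl_iff, Set.mem_union, not_or] using this.1
      have hx2P : ∀ a, a ∈ x₂ → a ∈ P → False := fun a ha haP => by
        by_cases haQ : a ∈ Q
        · exact (hTx3 a ⟨haP, haQ⟩).2 ha
        · have : a ∈ P \ Q ∩ x₂ := ⟨⟨haP, haQ⟩, ha⟩
          rw [h3a] at this; exact this
      simp only [ororInv, fin10, if_false, if_true]
      have c1 : ¬ (x₂ ∩ P).Nonempty := by rintro ⟨a, ha2, haP⟩; exact hx2P a ha2 haP
      have c2 : ¬ ((x₁ ∪ P ∩ Q) ∩ (Q \ P)).Nonempty := by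
        rintro ⟨a, ha | ha, haQP⟩
        · exact hx1Q a ha haQP.1
        · exact haQP.2 ha.1
      have c3 : ¬ (((x₁ ∪ P ∩ Q) ∪ x₂)ᶜ ∩ Q).Nonempty := by
        rintro ⟨a, ha, haQ⟩
        simp only [Set.mem_compl_iff, Set.mem_union, not_or] at ha
        have : a ∈ (x₁ ∪ x₂)ᶜ ∩ Q := ⟨by simp only [Set.mem_compl_iff, Set.mem_union, not_or]; exact ⟨ha.1.1, ha.2⟩, haQ⟩
        rw [h3c] at this
        exact ha.1.2 this
      rw [if_neg c1, if_neg c2, if_neg c3]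
      refine tok_eq ?_ rfl rfl
      ext c; simp only [Set.mem_sdiff, Set.mem_union, Set.mem_inter_iff]
      constructor
      · rintro ⟨hc | hc, hcT⟩
        · exact hc
        · exact absurd hc hcT
      · intro hc; exact ⟨Or.inl hc, fun hT => hx1Q c hc hT.2⟩
    · -- canonical landing: target `((x₁ ∪ x₃ ∩ Q, x₂), 0)`
      have hx1Q : ∀ a, a ∈ x₁ → a ∈ Q → False := fun a ha haQ => h1 ⟨a, ha, haQ⟩
      have hA1 : (P \ Q ∩ x₁).Nonempty := by
        obtain ⟨b, hb⟩ := hV; exact ⟨b, ⟨hb.2, fun hbQ => hx1Q b hb.1 hbQ⟩, hb.1⟩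
      simp only [ororInv, if_true]
      have c1 : ¬ (((x₁ ∪ (x₁ ∪ x₂)ᶜ ∩ Q) ∪ x₂)ᶜ ∩ Q).Nonempty := by
        rintro ⟨a, ha, haQ⟩
        apply ha
        by_cases h : a ∈ x₁ ∪ x₂
        · rcases h with h | h
          · exact Or.inl (Or.inl h)
          · exact Or.inr h
        · exact Or.inl (Or.inr ⟨h, haQ⟩)
      have c2 : ((x₁ ∪ (x₁ ∪ x₂)ᶜ ∩ Q) ∩ (P \ Q)).Nonempty ∧
          ((x₂ ∩ (P \ Q)).Nonempty ∨ (P ∩ Q ⊆ x₁ ∪ (x₁ ∪ x₂)ᶜ ∩ Q ∧ (x₁ ∪ (x₁ ∪ x₂)ᶜ ∩ Q) ∩ Q ≠ P ∩ Q)) := by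
        have hA1' := hA1
        obtain ⟨b, hb⟩ := hA1'
        refine ⟨⟨b, Or.inl hb.2, hb.1⟩, ?_⟩
        by_cases hL : (x₂ ∩ (P \ Q)).Nonempty
        · exact Or.inl hL
        · right
          have hx2e : P \ Q ∩ x₂ = ∅ := by
            rw [Set.eq_empty_iff_forall_notMem]
            rintro a ⟨ha, ha2⟩; exact hL ⟨a, ha2, ha⟩
          have hT3 : P ∩ Q ⊆ (x₁ ∪ x₂)ᶜ := by
            by_contra hcon; exact h2 ⟨hx2e, hA1, hcon⟩
          have hne : (x₁ ∪ x₂)ᶜ ∩ Q ≠ P ∩ Q := fun heq => h3 ⟨hx2e, hA1, heq⟩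
          refine ⟨fun c hc => Or.inr ⟨hT3 hc, hc.2⟩, fun heq => hne ?_⟩
          rw [← heq]
          ext c; simp only [Set.mem_inter_iff, Set.mem_union]
          constructor
          · rintro ⟨hc, hcQ⟩; exact ⟨Or.inr ⟨hc, hcQ⟩, hcQ⟩
          · rintro ⟨hc | hc, hcQ⟩
            · exact absurd hcQ (fun h => hx1Q c hc h)
            · exact ⟨hc.1, hcQ⟩
      rw [if_neg c1, if_pos c2]
      refine tok_eq ?_ rfl rfl
      ext c; simp only [Set.mem_sdiff, Set.mem_union, Set.mem_inter_iff]
      constructor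
      · rintro ⟨hc | hc, hcQ⟩
        · exact hc
        · exact absurd hc.2 hcQ
      · intro hc; exact ⟨Or.inl hc, fun h => hx1Q c hc h⟩
  · -- N2
    simp only [ororMap, fin10, if_false, if_true]
    split_ifs with h1
    · simp only [ororInv, fin10, if_false, if_true]
      rw [if_pos hV2]
    · have hx1P : ∀ a, a ∈ x₁ → a ∈ P → False := fun a ha haP => h1 ⟨a, ha, haP⟩
      simp only [ororInv, fin10, if_false, if_true]
      have c1 : ¬ (x₂ \ P ∩ P).Nonempty := by rintro ⟨a, ha, haP⟩; exact ha.2 haP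
      have c2 : ((x₁ ∪ x₂ ∩ P) ∩ (Q \ P)).Nonempty := by
        obtain ⟨a, ha⟩ := hW1; exact ⟨a, Or.inl ha.1, ha.2, fun h => hx1P a ha.1 h⟩
      rw [if_neg c1, if_pos c2]
      refine tok_eq ?_ ?_ rfl
      · ext c; simp only [Set.mem_sdiff, Set.mem_union, Set.mem_inter_iff]
        constructor
        · rintro ⟨hc | hc, hcP⟩
          · exact hc
          · exact absurd hc.2 hcP
        · intro hc; exact ⟨Or.inl hc, fun h => hx1P c hc h⟩
      · ext c; simp only [Set.mem_sdiff, Set.mem_union, Set.mem_inter_iff]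
        constructor
        · rintro (⟨hc, _⟩ | ⟨hc | hc, hcP⟩)
          · exact hc
          · exact absurd hcP (fun h => hx1P c hc h)
          · exact hc.1
        · intro hc
          by_cases hcP : c ∈ P
          · exact Or.inr ⟨Or.inr ⟨hc, hcP⟩, hcP⟩
          · exact Or.inl ⟨hc, hcP⟩
  · -- N3
    simp only [ororMap, fin20, fin21, if_false]
    split_ifs with h1 h2 h3
    · -- own T₂
      simp only [ororInv, fin20, fin21, if_false]
      rw [if_pos hQ2]
    · -- exit: target `((x₁, x₂ ∖ Q), 2)`
      have hQsub : ∀ a, a ∈ Q → a ∈ x₁ ∨ a ∈ x₂ := fun a haQ => by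
        by_contra hcon
        exact h1 ⟨a, by simp only [Set.mem_compl_iff, Set.mem_union]; exact hcon, haQ⟩
      simp only [ororInv, fin20, fin21, if_false]
      have c1 : ¬ (x₂ \ Q ∩ Q).Nonempty := by rintro ⟨a, ha, haQ⟩; exact ha.2 haQ
      rw [if_neg c1]
      refine tok_eq rfl ?_ rfl
      ext c; simp only [Set.mem_sdiff, Set.mem_union, Set.mem_inter_iff, Set.mem_compl_iff, not_or]
      constructor
      · rintro (⟨hc, _⟩ | ⟨⟨hc1, hc2⟩, hcQ⟩)
        · exact hc
        · exact ((hQsub c hcQ).resolve_left hc1)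
      · intro hc
        by_cases hcQ : c ∈ Q
        · exact Or.inr ⟨⟨fun h => hd c h hc, fun h => h.2 hcQ⟩, hcQ⟩
        · exact Or.inl ⟨hc, hcQ⟩
    · -- shift: target `((x₁ ∪ T, x₂ ∖ T), 0)`
      obtain ⟨hTsub, hrest⟩ := h3
      have hu : (x₁ ∪ P ∩ Q) ∪ x₂ \ (P ∩ Q) = x₁ ∪ x₂ := by
        ext c; simp only [Set.mem_union, Set.mem_inter_iff, Set.mem_sdiff]
        constructor
        · rintro ((h | h) | h)
          · exact Or.inl h
          · exact Or.inr (hTsub h)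
          · exact Or.inr h.1
        · rintro (h | h)
          · exact Or.inl (Or.inl h)
          · by_cases hc : c ∈ P ∧ c ∈ Q
            · exact Or.inl (Or.inr hc)
            · exact Or.inr ⟨h, hc⟩
      have hx1T : ∀ a, a ∈ x₁ → a ∈ P ∩ Q → False := fun a ha haT => hd a ha (hTsub haT)
      simp only [ororInv, if_true]
      have c1 : ¬ (((x₁ ∪ P ∩ Q) ∪ x₂ \ (P ∩ Q))ᶜ ∩ Q).Nonempty := by rw [hu]; exact h1
      have c2 : ¬ (((x₁ ∪ P ∩ Q) ∩ (P \ Q)).Nonempty ∧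
          ((x₂ \ (P ∩ Q) ∩ (P \ Q)).Nonempty ∨ (P ∩ Q ⊆ x₁ ∪ P ∩ Q ∧ (x₁ ∪ P ∩ Q) ∩ Q ≠ P ∩ Q))) := by
        rintro ⟨⟨b, hb1, hbP⟩, hor⟩
        have hb : b ∈ x₁ := hb1.elim id (fun h => absurd h.2 hbP.2)
        have hA1 : (P \ Q ∩ x₁).Nonempty := ⟨b, hbP, hb⟩
        have hA1' : ¬ (P \ Q ∩ x₁ = ∅) := fun he => by rw [he] at hA1; exact Set.not_nonempty_empty hA1
        rcases hrest with ⟨hL, hcase⟩ | ⟨hL, hA, _⟩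
        · rcases hcase with hA | hQx2
          · exact hA1' hA
          · rcases hor with ⟨a, ha, haP⟩ | ⟨_, hne⟩
            · exact hL ⟨a, ha.1, haP⟩
            · apply hne
              ext c; simp only [Set.mem_inter_iff, Set.mem_union]
              constructor
              · rintro ⟨hc | hc, hcQ⟩
                · exact absurd (hQx2 hcQ) (fun h2 => hd c hc h2)
                · exact hc
              · intro hc; exact ⟨Or.inr hc, hc.2⟩
        · exact hA1' hA
      have c3 : ¬ ((x₂ \ (P ∩ Q) ∩ P).Nonempty ∧ (x₂ \ (P ∩ Q) ∩ Q).Nonempty) := by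
        rintro ⟨⟨a, ha, haP⟩, ⟨b, hb, hbQ⟩⟩
        rcases hrest with ⟨hL, _⟩ | ⟨_, _, hQT⟩
        · -- `x₂ ∩ P' = ∅` forces `a ∈ T`
          by_cases haQ : a ∈ Q
          · exact ha.2 ⟨haP, haQ⟩
          · exact hL ⟨a, ha.1, haP, haQ⟩
        · have : b ∈ x₂ ∩ Q := ⟨hb.1, hbQ⟩
          rw [hQT] at this; exact hb.2 this
      rw [if_neg c1, if_neg c2, if_neg c3]
      refine tok_eq ?_ ?_ rfl
      · ext c; simp only [Set.mem_sdiff, Set.mem_union, Set.mem_inter_iff]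
        constructor
        · rintro ⟨hc | hc, hcT⟩
          · exact hc
          · exact absurd hc hcT
        · intro hc; exact ⟨Or.inl hc, fun h => hx1T c hc h⟩
      · ext c; simp only [Set.mem_sdiff, Set.mem_union, Set.mem_inter_iff]
        constructor
        · rintro (⟨hc, _⟩ | hc)
          · exact hc
          · exact hTsub hc
        · intro hc
          by_cases hcT : c ∈ P ∧ c ∈ Q
          · exact Or.inr hcT
          · exact Or.inl ⟨hc, hcT⟩
    · -- own unit a: target `((x₁, x₂), 0)`
      simp only [ororInv, if_true]
      have c2 : ¬ ((x₁ ∩ (P \ Q)).Nonempty ∧ ((x₂ ∩ (P \ Q)).Nonempty ∨ (P ∩ Q ⊆ x₁ ∧ x₁ ∩ Q ≠ P ∩ Q))) := by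
        rintro ⟨⟨b, hb, hbP⟩, hor⟩
        have hA1 : (P \ Q ∩ x₁).Nonempty := ⟨b, hbP, hb⟩
        rcases hor with hL | ⟨hT1, _⟩
        · exact h2 ⟨hL, Or.inl hA1⟩
        · -- `¬L`: then `x₂ ∩ P ⊆ T ⊆ x₁`, contradicting `x₂ ∩ P ≠ ∅`
          obtain ⟨a, ha2, haP⟩ := hP2
          by_cases hL : (x₂ ∩ (P \ Q)).Nonempty
          · exact h2 ⟨hL, Or.inl hA1⟩
          · have haQ : a ∈ Q := by
              by_contra haQ; exact hL ⟨a, ha2, haP, haQ⟩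
            exact hd a (hT1 ⟨haP, haQ⟩) ha2
      rw [if_neg h1, if_neg c2, if_pos ⟨hP2, hQ2⟩]

/-! ## The theorem -/

/-- **`TypedMatchable ∅ (OR P) (OR Q)`** — the typed matching for two disjunctions, untwisted, for ALL `P, Q` (the nested and disjoint-support
sub-cases included: the explicit map does not need the case distinction). [this work] -/
theorem typedMatchable_orOr (P Q : Set ι) : TypedMatchable (∅ : Set ι) (orFam P) (orFam Q) :=
  ⟨ororMap P Q, fun t ht => ororMap_spec P Q ht, fun t ht t' ht' h => by
    have e := congrArg (ororInv P Q) h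
    rwa [ororInv_ororMap P Q ht, ororInv_ororMap P Q ht'] at e⟩

/-- Hence a grid-order token matching and `∑_{q∈𝒰} κ ≥ 0` for every grid up-set `𝒰`, for the untwisted OR–OR instances. [this work] -/
theorem gtMatchable_orOr (P Q : Set ι) : GTMatchable (∅ : Set ι) (orFam P) (orFam Q) :=
  gtMatchable_of_typedMatchable (typedMatchable_orOr P Q)

end Summit.CriticalPhenomena.PercolationContinuityZ3.Theorems.ThreePartition

end
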